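/-
Copyright (c) 2026 the pub-hodgecm-mathlib formalisation cell (harness21).  Prover seat hodgecm-mathlib-K2Liu-p03 (g9), Track B «K2-LIT» ∕ hLiu418 #184♮ =
`stmt-HodgeConjecture-24832`, socket #41 KIND 1, block K1-b♮ (dec-2-pay) F3-rec (K1b desk K2Liu-p14 (g5) WORD #15 (3), alternative branch: «F3 carries the translate
chain»; K2Liu-p11 (g6) 03:27:27Z «=»): THE FINITE-HALF LETTER `hFfin` OF ★ p865057 `K2LiuKindOneLineBlockLetterOfRecord.blockLetter_rate_of_record`, IN ITS FROZEN
`H(h)·D^{a₂}·(1+‖ι S‖)^{N₀}` CURRENCY, FROM ONE BOUND IN THE TRANSLATE'S HEIGHT.  THEOREMS ONLY (no `def`, no `instance`, no notation, no named-fact hypothesis, no `sorry`);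
lane `--supports stmt-HodgeConjecture-24832 --as helper`.
-/
import Summits.HodgeConjecture.HodgeConjecture.Theorems.K2LiuKindOneLineBlockLetterOfRecord    -- ★ p865057 (K2Liu-p11 (g6)): the CONSUMER — its `hFfin` binder :271–:285 is this file's conclusion VERBATIM
import Summits.HodgeConjecture.HodgeConjecture.Theorems.K2LiuKindOneLineTranslateHeight       -- ★ `adelicHeightGL_leviRow_translate_le` (the translate chain)
import Summits.HodgeConjecture.HodgeConjecture.Theorems.K2LiuRowSectionHeightLeVecHeight      -- ★ (B-ii) `exists_adelicHeightGL_rowSection_le`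
import Summits.HodgeConjecture.HodgeConjecture.Theorems.K2LiuVecHeightVsMulHeight            -- ★ p863361 (B-i) `exists_vecHeight_principalVec_le_mulHeight_pow`
import Summits.HodgeConjecture.HodgeConjecture.Theorems.K2LiuLeviHomHeightBound              -- ★ (B-iii) `exists_adelicHeightGL_leviHom_le_sq`
import HarnessLib

/-!
# Crux `HLiu418`, socket #41, KIND 1 b♮ (dec-2-pay) F3-rec — `K2LiuKindOneLineFiniteHalfOfRecord`: THE FINITE-HALF LETTER `hFfin` OF ★ p865057 FROM ONE
# TRANSLATE-HEIGHT BOUND `‖Ffin i σf x s‖ ≤ Cf · ‖x‖^{af}`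

Cell `hodgecm-mathlib`, crux item hLiu418 = `stmt-HodgeConjecture-24832` (helper lane, count-neutral).  Namespace `…Cruxes.HLiu418.K2LiuKindOneLineFiniteHalfOfRecord`.
WHY.  ★ p865057 `blockLetter_rate_of_record` (and its A-line twin ★ p865096) take the finite-half letter `hFfin` in the `H(h)`-currency of ★ p864699's `hBL₁`:
`‖Ffin i σf (Λ₀γ̂·h) s‖ ≤ Cf·‖h‖^{af}·D^{a₂}·(1+‖ι_∞ S‖)^{N₀}` over the corner data `(S = u ⊗ w, γ̂ = γ₀[w], D·S integral)`.  The local majorants (★ F3-loc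
`K2LiuKindOneLineLocalAbsoluteMajorant`, ★ F3-asm `K2LiuKindOneLineFiniteHalfBound`) live in the height of the TRANSLATE `x = Λ₀γ̂·h`; K1b desk WORD #15 (3) ruled the
chain `‖Λ₀γ̂·h‖ ≤ C·(D(1+‖ι S‖))^{kk}·‖h‖` (★ `adelicHeightGL_leviRow_translate_le` over ★ (B-i)(B-ii)(B-iii), exactly as ★ p864306∕p864641 at n = 2) is typed ONCE, here.
So THIS FILE turns ONE letter in the translate's height,
`hFx : ∀ z, 0 < re z → ∃ Cf af r, 0 ≤ Cf ∧ 0 ≤ af ∧ 0 < r ∧ ∀ i σf x s, dist s z < r → ‖Ffin i σf x s‖ ≤ Cf·‖x‖^{af}` (`Ffin` a free binder: F2's witness),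
into ★ p865057's `hFfin` binder type VERBATIM (`Cf′ := Cf·C^{af}`, `af′ := af`, `a₂ := kk·af`, `N₀ := ⌈kk·af⌉₊`, `kk = [L:ℚ]·2k₁`), given the frame data
`(hdV0 hdW0) (Λ₀ hΛ₀) (γ₀ hnorm)` of record (★ p863630 preamble ∕ ★ `exists_normalised_rowSection`).
* §1 `vecMulVec_ne_zero_of_ne` (`u ≠ 0`, `w ≠ 0` ⇒ `u ⊗ w ≠ 0`), `rpow_pow_mul_le` (`((D·t)^{kk})^{af} ≤ D^{kk·af}·t^{⌈kk·af⌉₊}` for `1 ≤ t`, `0 ≤ D`);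
* §2 **`hFfin_of_translateHeightBound`** — the head.
References: [BorelJacquet1979, §1.2]; [MoeglinWaldspurger1995, I.2.2, II.1.7]; [BombieriGubler2006, §1.5]; [KudlaRallis1994, §2 (2.10)–(2.12)].  HONEST LABEL: HC_CM is
proved only modulo the 7 printed citations (2 remaining named inputs: hLiu418 = stmt-HodgeConjecture-24832, h413 = stmt-HodgeConjecture-24833) until rung 0 closes;
count-neutral helper (`--supports stmt-HodgeConjecture-24832 --as helper`), hypothesis-first in `hFx` (payers: ★ F3-asm ∘ F3-loc ∘ F2's `hFfin_def`).
-/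

set_option autoImplicit false
set_option linter.dupNamespace false -- the mandated namespace repeats `HodgeConjecture.HodgeConjecture`

noncomputable section

open scoped Matrix NNReal MatrixGroups
open NumberField NumberField.InfinitePlace IsDedekindDomain

namespace Summit.HodgeConjecture.HodgeConjecture.Cruxes.HLiu418.K2LiuKindOneLineFiniteHalfOfRecord

open Literature.NumberTheory.Automorphic Literature.NumberTheory.Automorphic.UnitaryGroup Literature.NumberTheory.GaloisRepresentations
open Literature.NumberTheory.GelbartRogawski1991 Literature.NumberTheory.GelbartRogawski1991.GRConstruction
open Literature.NumberTheory.GelbartRogawski1991.AdaptedBlocks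
open Literature.NumberTheory.GelbartRogawski1991.UnitaryDualPair
open Literature.NumberTheory.K2Lit.SiegelDoubled
open Summit.HodgeConjecture.HodgeConjecture.Cruxes.HLiu418.K2LiuSiegelUnipotentFourierDefs
open Summit.HodgeConjecture.HodgeConjecture.Cruxes.HLiu418.K2LiuSiegelUnipotentCharacters
open Summit.HodgeConjecture.HodgeConjecture.Cruxes.HLiu418.K2LiuKindOneLineTranslateHeight (adelicHeightGL_leviRow_translate_le)
open Summit.HodgeConjecture.HodgeConjecture.Cruxes.HLiu418.K2LiuRowSectionHeightLeVecHeight (exists_adelicHeightGL_rowSection_le)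
open Summit.HodgeConjecture.HodgeConjecture.Cruxes.HLiu418.K2LiuVecHeightVsMulHeight (exists_vecHeight_principalVec_le_mulHeight_pow)
open Summit.HodgeConjecture.HodgeConjecture.Cruxes.HLiu418.K2LiuLeviHomHeightBound (exists_adelicHeightGL_leviHom_le_sq)

/-! ## §1 Tools -/

section Tools

/-- `u ≠ 0` and `w ≠ 0` give `u ⊗ w ≠ 0` (a rank-one matrix with a non-zero entry `u i · w j`). [folklore] -/
theorem vecMulVec_ne_zero_of_ne {K : Type*} [Field K] {ι κ : Type*} {u : ι → K} {w : κ → K} (hu : u ≠ 0) (hw : w ≠ 0) :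
    Matrix.vecMulVec u w ≠ 0 := by
  obtain ⟨i, hi⟩ := Function.ne_iff.1 hu
  obtain ⟨j, hj⟩ := Function.ne_iff.1 hw
  intro h0
  have h := congrFun (congrFun h0 i) j
  rw [Matrix.vecMulVec_apply, Matrix.zero_apply] at h
  exact (mul_ne_zero hi hj) h

/-- **`((D·t)^{kk})^{af} ≤ D^{kk·af} · t^{⌈kk·af⌉₊}`** for `0 ≤ D`, `1 ≤ t` (real-power bookkeeping: the `(1 + ‖ι S‖)`-factor is raised to a NATURAL exponent).
[folklore] -/
theorem rpow_pow_mul_le {D t af : ℝ} (hD : 0 ≤ D) (ht : 1 ≤ t) (kk : ℕ) :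
    ((D * t) ^ kk) ^ af ≤ D ^ ((kk : ℝ) * af) * t ^ ⌈(kk : ℝ) * af⌉₊ := by
  have ht0 : 0 ≤ t := zero_le_one.trans ht
  rw [← Real.rpow_natCast, ← Real.rpow_mul (mul_nonneg hD ht0), Real.mul_rpow hD ht0]
  refine mul_le_mul_of_nonneg_left ?_ (Real.rpow_nonneg hD _)
  calc t ^ ((kk : ℝ) * af) ≤ t ^ ((⌈(kk : ℝ) * af⌉₊ : ℕ) : ℝ) := Real.rpow_le_rpow_of_exponent_le ht (Nat.le_ceil _)
    _ = t ^ ⌈(kk : ℝ) * af⌉₊ := Real.rpow_natCast _ _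

end Tools

/-! ## §2 The finite-half letter of ★ p865057 from one translate-height bound -/

section Head

variable (L : Type) [Field L] [NumberField L] [IsCMField L] {N M : ℕ} (e : Fin N × Fin M ≃ Fin 2)
  (dV : Fin N → L) (hdV : ∀ i, IsCMField.complexConj L (dV i) = dV i)
  (dW : Fin M → L) (hdW : ∀ i, IsCMField.complexConj L (dW i) = dW i)

open Classical in -- the archimedean size `‖(ι_∞ S_ab)_ab‖` is read with the consumers' instances (★ p864699 ∕ ★ p865057: `open scoped Classical`)
/-- **(K1b-dec-2-pay) F3-rec: THE FINITE-HALF LETTER `hFfin` OF ★ p865057 FROM ONE TRANSLATE-HEIGHT BOUND.**  Frame data by value: `hdV0 hdW0`, the Levi homomorphism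
`Λ₀` with its `cayR`-presentation `hΛ₀` (★ p863630's preamble), the NORMALISED row section `γ₀` with `hnorm` (★ `exists_normalised_rowSection`); the finite-half family
`Ffin` (a free binder — F2's witness) and ONE letter `hFx` bounding it in the TRANSLATE's height near every `z` with `0 < re z`.  THEN ★ p865057's `hFfin` binder type
VERBATIM (constants `r`, `Cf·C^{af}`, `af`, `a₂ := kk·af`, `N₀ := ⌈kk·af⌉₊`, `C = 4·C₃(C₂C₁)²`, `kk = [L:ℚ]·2k₁` from the ★ translate chain).
[cite: BorelJacquet1979, §1.2] [cite: MoeglinWaldspurger1995, I.2.2, II.1.7] [cite: BombieriGubler2006, §1.5] [cite: KudlaRallis1994, §2 (2.10)–(2.12)] -/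
theorem hFfin_of_translateHeightBound (hdV0 : ∀ i, dV i ≠ 0) (hdW0 : ∀ i, dW i ≠ 0)
    (Λ₀ : GL (Fin 2) (AdeleRing (𝓞 L) L) →* HA L e dV hdV dW hdW)
    (hΛ₀ : ∀ g : GL (Fin 2) (AdeleRing (𝓞 L) L), blk L e dV hdV dW hdW (Λ₀ g) =
      cayR (AdeleRing (𝓞 L) L) (Fin 2) * Matrix.fromBlocks (g : Matrix (Fin 2) (Fin 2) (AdeleRing (𝓞 L) L)) 0 0
        (((gramR L e dV hdV dW hdW).map ((algebraMap L (AdeleRing (𝓞 L) L)).comp (algebraMap (Fp L) L)))⁻¹ *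
          (((g⁻¹ : GL (Fin 2) (AdeleRing (𝓞 L) L)) : Matrix (Fin 2) (Fin 2) (AdeleRing (𝓞 L) L)).map
            (conjAdele (Fp L) L (IsCMField.complexConj L)))ᵀ *
          (gramR L e dV hdV dW hdW).map ((algebraMap L (AdeleRing (𝓞 L) L)).comp (algebraMap (Fp L) L))) *
        cayRinv (AdeleRing (𝓞 L) L) (Fin 2))
    (γ₀ : Projectivization L (Fin 2 → L) → GL (Fin 2) L)
    (hnorm : ∀ (w : Fin 2 → L) (hw : w ≠ 0), ∃ i : Fin 2, w i ≠ 0 ∧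
      (γ₀ (Projectivization.mk L w hw) : Matrix (Fin 2) (Fin 2) L) 1 = (w i)⁻¹ • w ∧
      ∀ a b : Fin 2,
        (∃ k : Fin 2, (γ₀ (Projectivization.mk L w hw) : Matrix (Fin 2) (Fin 2) L) a b = 0 ∨
          (γ₀ (Projectivization.mk L w hw) : Matrix (Fin 2) (Fin 2) L) a b = 1 ∨
          (γ₀ (Projectivization.mk L w hw) : Matrix (Fin 2) (Fin 2) L) a b = (w i)⁻¹ * w k ∨
          (γ₀ (Projectivization.mk L w hw) : Matrix (Fin 2) (Fin 2) L) a b = -((w i)⁻¹ * w k)) ∧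
        (∃ k : Fin 2, (((γ₀ (Projectivization.mk L w hw))⁻¹ : GL (Fin 2) L) : Matrix (Fin 2) (Fin 2) L) a b = 0 ∨
          (((γ₀ (Projectivization.mk L w hw))⁻¹ : GL (Fin 2) L) : Matrix (Fin 2) (Fin 2) L) a b = 1 ∨
          (((γ₀ (Projectivization.mk L w hw))⁻¹ : GL (Fin 2) L) : Matrix (Fin 2) (Fin 2) L) a b = (w i)⁻¹ * w k ∨
          (((γ₀ (Projectivization.mk L w hw))⁻¹ : GL (Fin 2) L) : Matrix (Fin 2) (Fin 2) L) a b = -((w i)⁻¹ * w k)))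
    {m : ℕ} (Ffin : Fin m → L → HA L e dV hdV dW hdW → ℂ → ℂ)
    (hFx : ∀ z : ℂ, 0 < z.re → ∃ (Cf af r : ℝ), 0 ≤ Cf ∧ 0 ≤ af ∧ 0 < r ∧
      ∀ (i : Fin m) (σf : L) (x : HA L e dV hdV dW hdW) (s : ℂ), dist s z < r →
        ‖Ffin i σf x s‖ ≤ Cf * adelicHeightGL (2 + 2) L (x : GL (Fin (2 + 2)) (AdeleRing (𝓞 L) L)) ^ af) :
    ∀ z : ℂ, 0 < z.re → ∃ (r Cf af a₂ : ℝ) (N₀ : ℕ), 0 < r ∧ 0 ≤ Cf ∧ 0 ≤ af ∧ 0 ≤ a₂ ∧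
            ∀ (S : skewMatrices ((IsCMField.complexConj L : L ≃ₐ[Fp L] L) : L →+* L) ((gramR L e dV hdV dW hdW).map (algebraMap (Fp L) L))) (u w : Fin 2 → L),
        (S : Matrix (Fin 2) (Fin 2) L) = Matrix.vecMulVec u w → u ≠ 0 → ∀ (hw : w ≠ 0) (S' : Matrix (Fin 2) (Fin 2) L),
        (∀ v : HA L e dV hdV dW hdW, v ∈ unipDelta L e dV hdV dW hdW →
          unipDeltaChar L e dV hdV dW hdW (S : Matrix (Fin 2) (Fin 2) L) ((Λ₀ (Matrix.GeneralLinearGroup.map (algebraMap L (AdeleRing (𝓞 L) L)) (γ₀ (Projectivization.mk L w hw))))⁻¹ * v * Λ₀ (Matrix.GeneralLinearGroup.map (algebraMap L (AdeleRing (𝓞 L) L)) (γ₀ (Projectivization.mk L w hw)))) =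
            unipDeltaChar L e dV hdV dW hdW S' v) →
        ∀ D : ℕ, 1 ≤ D → (∀ i j, IsIntegral ℤ ((D : L) * (S : Matrix (Fin 2) (Fin 2) L) i j)) →
        ∀ (D₀ : Matrix (Fin 2) (Fin 2) L) (σf : L),
        (((γ₀ (Projectivization.mk L w hw) : GL (Fin 2) L) : Matrix (Fin 2) (Fin 2) L).map ((IsCMField.complexConj L : L ≃ₐ[Fp L] L) : L →+* L))ᵀ * (gramR L e dV hdV dW hdW).map (algebraMap (Fp L) L) * D₀ =
            (gramR L e dV hdV dW hdW).map (algebraMap (Fp L) L) →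
        D₀ * (S : Matrix (Fin 2) (Fin 2) L) * ((γ₀ (Projectivization.mk L w hw) : GL (Fin 2) L) : Matrix (Fin 2) (Fin 2) L)⁻¹ = Matrix.single 1 1 σf →
        ∀ s : ℂ, dist s z < r → ∀ (h : HA L e dV hdV dW hdW) (i : Fin m),
        ‖Ffin i σf (Λ₀ (Matrix.GeneralLinearGroup.map (algebraMap L (AdeleRing (𝓞 L) L)) (γ₀ (Projectivization.mk L w hw))) * h) s‖ ≤
          Cf * adelicHeightGL (2 + 2) L (h : GL (Fin (2 + 2)) (AdeleRing (𝓞 L) L)) ^ af * (D : ℝ) ^ a₂ *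
            (1 + ‖(fun i j => NumberField.mixedEmbedding L ((S : Matrix (Fin 2) (Fin 2) L) i j))‖) ^ N₀ := by
  intro z hz
  obtain ⟨Cf, af, r, hCf, haf, hr, hb⟩ := hFx z hz
  -- the height clause of `Λ₀ ∘ γ₀` (★ (B-i)(B-ii)(B-iii), as in ★ p864306 ∕ ★ p864641)
  obtain ⟨C₁, k₁, hC₁, hBi⟩ := exists_vecHeight_principalVec_le_mulHeight_pow (K := L) (ι := Fin 2)
  obtain ⟨C₂, hC₂, hBii⟩ := exists_adelicHeightGL_rowSection_le L
  obtain ⟨C₃, hC₃, hBiii⟩ := exists_adelicHeightGL_leviHom_le_sq L e dV hdV dW hdW hdV0 hdW0 Λ₀ hΛ₀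
  have hclause : ∀ (w' : Fin 2 → L) (hw' : w' ≠ 0),
      adelicHeightGL (2 + 2) L ((fun g : GL (Fin 2) (AdeleRing (𝓞 L) L) => ((Λ₀ g : HA L e dV hdV dW hdW) : GL (Fin (2 + 2)) (AdeleRing (𝓞 L) L)))
        (Matrix.GeneralLinearGroup.map (algebraMap L (AdeleRing (𝓞 L) L)) (γ₀ (Projectivization.mk L w' hw')))) ≤
        (C₃ * (C₂ * C₁) ^ 2) * Height.mulHeight w' ^ (2 * k₁) := by
    intro w' hw'
    obtain ⟨i, hi, -, hent⟩ := hnorm w' hw'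
    have h12 : adelicHeightGL 2 L (Matrix.GeneralLinearGroup.map (algebraMap L (AdeleRing (𝓞 L) L)) (γ₀ (Projectivization.mk L w' hw'))) ≤
        C₂ * C₁ * Height.mulHeight w' ^ k₁ :=
      calc adelicHeightGL 2 L (Matrix.GeneralLinearGroup.map (algebraMap L (AdeleRing (𝓞 L) L)) (γ₀ (Projectivization.mk L w' hw')))
          ≤ C₂ * ((vecHeight L (principalVec L w') : ℝ≥0) : ℝ) := hBii w' i hi _ hent
        _ ≤ C₂ * (C₁ * Height.mulHeight w' ^ k₁) := mul_le_mul_of_nonneg_left (hBi w' hw') hC₂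
        _ = C₂ * C₁ * Height.mulHeight w' ^ k₁ := by ring
    have h0 : 0 ≤ adelicHeightGL 2 L (Matrix.GeneralLinearGroup.map (algebraMap L (AdeleRing (𝓞 L) L)) (γ₀ (Projectivization.mk L w' hw'))) :=
      adelicHeightGL_nonneg _
    calc adelicHeightGL (2 + 2) L ((Λ₀ (Matrix.GeneralLinearGroup.map (algebraMap L (AdeleRing (𝓞 L) L)) (γ₀ (Projectivization.mk L w' hw'))) :
            HA L e dV hdV dW hdW) : GL (Fin (2 + 2)) (AdeleRing (𝓞 L) L))
        ≤ C₃ * adelicHeightGL 2 L (Matrix.GeneralLinearGroup.map (algebraMap L (AdeleRing (𝓞 L) L)) (γ₀ (Projectivization.mk L w' hw'))) ^ 2 := hBiii _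
      _ ≤ C₃ * (C₂ * C₁ * Height.mulHeight w' ^ k₁) ^ 2 := mul_le_mul_of_nonneg_left (pow_le_pow_left₀ h0 h12 2) hC₃
      _ = (C₃ * (C₂ * C₁) ^ 2) * Height.mulHeight w' ^ (2 * k₁) := by ring
  have hC₀ : 0 ≤ C₃ * (C₂ * C₁) ^ 2 := by positivity
  -- constants
  obtain ⟨kk, hkk⟩ : ∃ kk : ℕ, kk = Module.finrank ℚ L * (2 * k₁) := ⟨_, rfl⟩
  obtain ⟨C, hC⟩ : ∃ C : ℝ, C = ((2 + 2 : ℕ) : ℝ) * (C₃ * (C₂ * C₁) ^ 2) := ⟨_, rfl⟩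
  have hC0 : 0 ≤ C := by rw [hC]; positivity
  refine ⟨r, Cf * C ^ af, af, (kk : ℝ) * af, ⌈(kk : ℝ) * af⌉₊, hr, by positivity, haf, by positivity,
    fun S u w hS hu hw S' _ D hD hDint D₀ σf _ _ s hs h i => ?_⟩
  -- the translate chain
  have hS' : Matrix.vecMulVec u w ≠ 0 := vecMulVec_ne_zero_of_ne hu hw
  have hint' : ∀ a b, IsIntegral ℤ ((D : L) * Matrix.vecMulVec u w a b) := fun a b => by rw [← hS]; exact hDint a b
  have htr := adelicHeightGL_leviRow_translate_le L
    (fun g : GL (Fin 2) (AdeleRing (𝓞 L) L) => ((Λ₀ g : HA L e dV hdV dW hdW) : GL (Fin (2 + 2)) (AdeleRing (𝓞 L) L))) γ₀ hC₀ hclause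
    u w hw hS' hD hint' (h : GL (Fin (2 + 2)) (AdeleRing (𝓞 L) L))
  rw [← hS, ← hkk, ← hC] at htr
  -- abbreviations
  obtain ⟨t, ht⟩ : ∃ t : ℝ, t = 1 + ‖(fun i j => NumberField.mixedEmbedding L ((S : Matrix (Fin 2) (Fin 2) L) i j))‖ := ⟨_, rfl⟩
  have ht1 : 1 ≤ t := by rw [ht]; exact le_add_of_nonneg_right (norm_nonneg _)
  have ht0 : 0 ≤ t := zero_le_one.trans ht1
  rw [← ht] at htr ⊢
  have hD0 : (0 : ℝ) ≤ D := Nat.cast_nonneg D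
  obtain ⟨Hh, hHh⟩ : ∃ Hh : ℝ, Hh = adelicHeightGL (2 + 2) L (h : GL (Fin (2 + 2)) (AdeleRing (𝓞 L) L)) := ⟨_, rfl⟩
  have hHh0 : 0 ≤ Hh := by rw [hHh]; exact adelicHeightGL_nonneg _
  rw [← hHh] at htr ⊢
  -- the translate's height and the letter
  have hx := hb i σf (Λ₀ (Matrix.GeneralLinearGroup.map (algebraMap L (AdeleRing (𝓞 L) L)) (γ₀ (Projectivization.mk L w hw))) * h) s hs
  have hgh : ((Λ₀ (Matrix.GeneralLinearGroup.map (algebraMap L (AdeleRing (𝓞 L) L)) (γ₀ (Projectivization.mk L w hw))) * h : HA L e dV hdV dW hdW) :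
        GL (Fin (2 + 2)) (AdeleRing (𝓞 L) L)) =
      ((Λ₀ (Matrix.GeneralLinearGroup.map (algebraMap L (AdeleRing (𝓞 L) L)) (γ₀ (Projectivization.mk L w hw))) : HA L e dV hdV dW hdW) :
        GL (Fin (2 + 2)) (AdeleRing (𝓞 L) L)) * (h : GL (Fin (2 + 2)) (AdeleRing (𝓞 L) L)) := rfl
  rw [hgh] at hx
  have hX0 : 0 ≤ adelicHeightGL (2 + 2) L
      (((Λ₀ (Matrix.GeneralLinearGroup.map (algebraMap L (AdeleRing (𝓞 L) L)) (γ₀ (Projectivization.mk L w hw))) : HA L e dV hdV dW hdW) :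
        GL (Fin (2 + 2)) (AdeleRing (𝓞 L) L)) * (h : GL (Fin (2 + 2)) (AdeleRing (𝓞 L) L))) := adelicHeightGL_nonneg _
  have hR0 : 0 ≤ C * (↑D * t) ^ kk * Hh := by positivity
  -- `‖x‖^{af} ≤ (C·(D t)^{kk}·‖h‖)^{af} = C^{af}·((D t)^{kk})^{af}·‖h‖^{af} ≤ C^{af}·D^{kk af}·t^{⌈kk af⌉}·‖h‖^{af}`
  have h1 : adelicHeightGL (2 + 2) L
      (((Λ₀ (Matrix.GeneralLinearGroup.map (algebraMap L (AdeleRing (𝓞 L) L)) (γ₀ (Projectivization.mk L w hw))) : HA L e dV hdV dW hdW) :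
        GL (Fin (2 + 2)) (AdeleRing (𝓞 L) L)) * (h : GL (Fin (2 + 2)) (AdeleRing (𝓞 L) L))) ^ af ≤ (C * (↑D * t) ^ kk * Hh) ^ af :=
    Real.rpow_le_rpow hX0 htr haf
  have h2 : (C * (↑D * t) ^ kk * Hh) ^ af = C ^ af * ((↑D * t) ^ kk) ^ af * Hh ^ af := by
    rw [Real.mul_rpow (by positivity) hHh0, Real.mul_rpow hC0 (by positivity)]
  have h3 : ((↑D * t) ^ kk) ^ af ≤ (D : ℝ) ^ ((kk : ℝ) * af) * t ^ ⌈(kk : ℝ) * af⌉₊ := rpow_pow_mul_le hD0 ht1 kk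
  have h4 : 0 ≤ C ^ af := Real.rpow_nonneg hC0 _
  have h5 : 0 ≤ Hh ^ af := Real.rpow_nonneg hHh0 _
  calc ‖Ffin i σf (Λ₀ (Matrix.GeneralLinearGroup.map (algebraMap L (AdeleRing (𝓞 L) L)) (γ₀ (Projectivization.mk L w hw))) * h) s‖
      ≤ Cf * (C * (↑D * t) ^ kk * Hh) ^ af := hx.trans (mul_le_mul_of_nonneg_left h1 hCf)
    _ = Cf * (C ^ af * ((↑D * t) ^ kk) ^ af * Hh ^ af) := by rw [h2]
    _ ≤ Cf * (C ^ af * ((D : ℝ) ^ ((kk : ℝ) * af) * t ^ ⌈(kk : ℝ) * af⌉₊) * Hh ^ af) :=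
        mul_le_mul_of_nonneg_left (mul_le_mul_of_nonneg_right (mul_le_mul_of_nonneg_left h3 h4) h5) hCf
    _ = Cf * C ^ af * Hh ^ af * (D : ℝ) ^ ((kk : ℝ) * af) * t ^ ⌈(kk : ℝ) * af⌉₊ := by ring

end Head

end Summit.HodgeConjecture.HodgeConjecture.Cruxes.HLiu418.K2LiuKindOneLineFiniteHalfOfRecord

end
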